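import Summits.KontsevichZagierPeriods.KontsevichZagierPeriods.Statement
import Literature.NumberTheory.Transcendental.KZRelationsLE

/-!
# Birth skeleton — piece `KZDimTwo` of the split of `DessinsDimensionOne.ExcursionBudget`

`KZDimTwo` (= stmt-KontsevichZagierPeriods-4280): Conjecture 1 on the stratum of dimension `≤ 2`.
Line: VOLUMES OF SOLIDS ("Hilbert's third problem for ℚ-semialgebraic solids, in KZ's calculus").

* `stub_solids` — Viu-Sos-lite: a KZ-rational representation of dimension `≤ 2` is KZ-equivalent to a
  difference of two VOLUME representations (integrand `1`) of dimension `3` (sign split by rule 1a/1b,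
  subgraph by one Newton–Leibniz move with primitive `t`, padding to dimension `3` by Newton–Leibniz
  cylinders; finite volume, compactness not needed). Known (ViuSos2021 Thm 1.1 performed inside the
  rules; cf. ScissorsTransport.DifferenceOfVolumes), size L.
* `stub_mergeSolids` — two volume representations of dimension `3` merge into one (compress into the
  unit box by `xᵢ ↦ xᵢ/√(1+xᵢ²)`, translate, disjoint union: rules 2 and 1a). Provable now, size M.
* `stub_solidVolumes` — THE OPEN CONTENT: two volume representations of dimension `3` with the same
  volume are KZ-equivalent (the volume form of Conjecture 1 at `N = 3` only; the all-`N` form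
  `VolumeForm` is summit-strength and is NOT used).
* `KZDimTwo_of` — real proof (≈ 35 lines): reduce both sides to differences of solids, cross-merge,
  compare volumes by soundness (`KZ.relations_le_ker_eval_holds`), apply `stub_solidVolumes`, and
  reassemble in the free abelian group.
-/

namespace Summit.KontsevichZagierPeriods.KontsevichZagierPeriods.Cruxes.ExcursionBudget.KZDimTwoLine

open Literature.NumberTheory.Transcendental

/-- Piece 1 of the split (verbatim; = BianchiHumbert.KZDimTwo = HodgeLevel.DimTwoRationalStratum). -/
def KZDimTwo : Prop :=
  ∀ ⦃n m : ℕ⦄, n ≤ 2 → m ≤ 2 → ∀ (r : Literature.NumberTheory.Transcendental.KZ.IntegralRep n) (r' : Literature.NumberTheory.Transcendental.KZ.IntegralRep m), r.IsRational → r'.IsRational → r.value = r'.value → Literature.NumberTheory.Transcendental.KZ.Equivalent r r'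

/-- A *volume representation*: integrand `1` on the domain. -/
def IsVolume {N : ℕ} (s : KZ.IntegralRep N) : Prop := ∀ z ∈ s.domain, s.integrand z = 1

/-- STUB 1 (Viu-Sos-lite, known, L): a KZ-rational representation of dimension `≤ 2` is KZ-equivalent
to a difference of volumes of two finite-volume `ℚ`-semialgebraic solids in `ℝ³`. -/
theorem stub_solids : ∀ ⦃n : ℕ⦄, n ≤ 2 → ∀ (r : KZ.IntegralRep n), r.IsRational →
    ∃ (s s' : KZ.IntegralRep 3), IsVolume s ∧ IsVolume s' ∧
      KZ.of r - (KZ.of s - KZ.of s') ∈ KZ.relations := by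
  sorry

/-- STUB 2 (merging, provable now, M): two volume representations of dimension `3` merge into one
volume representation (disjoint translated union inside a box). -/
theorem stub_mergeSolids : ∀ (s t : KZ.IntegralRep 3), IsVolume s → IsVolume t →
    ∃ u : KZ.IntegralRep 3, IsVolume u ∧ KZ.of u - KZ.of s - KZ.of t ∈ KZ.relations := by
  sorry

/-- STUB 3 (the open content): Hilbert's third problem for `ℚ`-semialgebraic solids in KZ's calculus —
two finite-volume volume representations of dimension `3` with equal volumes are KZ-equivalent. -/
theorem stub_solidVolumes : ∀ (u v : KZ.IntegralRep 3), IsVolume u → IsVolume v →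
    u.value = v.value → KZ.Equivalent u v := by
  sorry

/-- Soundness in value form: a relation evaluates to `0`. -/
theorem eval_eq_zero_of_mem {c : KZ.FormalRep} (hc : c ∈ KZ.relations) : KZ.eval c = 0 :=
  (AddMonoidHom.mem_ker).mp (KZ.relations_le_ker_eval_holds hc)

/-- COMPOSITION (real proof): solids + merging + Hilbert-3-for-solids give Conjecture 1 on the stratum `≤ 2`. -/
theorem KZDimTwo_of
    (h1 : ∀ ⦃n : ℕ⦄, n ≤ 2 → ∀ (r : KZ.IntegralRep n), r.IsRational →
      ∃ (s s' : KZ.IntegralRep 3), IsVolume s ∧ IsVolume s' ∧ KZ.of r - (KZ.of s - KZ.of s') ∈ KZ.relations)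
    (h2 : ∀ (s t : KZ.IntegralRep 3), IsVolume s → IsVolume t →
      ∃ u : KZ.IntegralRep 3, IsVolume u ∧ KZ.of u - KZ.of s - KZ.of t ∈ KZ.relations)
    (h3 : ∀ (u v : KZ.IntegralRep 3), IsVolume u → IsVolume v → u.value = v.value → KZ.Equivalent u v) :
    KZDimTwo := by
  intro n m hn hm r r' hr hr' hv
  obtain ⟨s, s', hs, hs', hrs⟩ := h1 hn r hr
  obtain ⟨t, t', ht, ht', hrt⟩ := h1 hm r' hr'
  -- cross-merge: u = s ⊔ t', v = t ⊔ s'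
  obtain ⟨u, hu, hum⟩ := h2 s t' hs ht'
  obtain ⟨v, hvv, hvm⟩ := h2 t s' ht hs'
  -- volumes agree: value u = s + t' = t + s' = value v
  have e1 := eval_eq_zero_of_mem hrs
  have e2 := eval_eq_zero_of_mem hrt
  have e3 := eval_eq_zero_of_mem hum
  have e4 := eval_eq_zero_of_mem hvm
  simp only [map_sub, KZ.eval_of] at e1 e2 e3 e4
  have huv : u.value = v.value := by linarith
  have hE : KZ.of u - KZ.of v ∈ KZ.relations := h3 u v hu hvv huv
  -- reassemble `[r] − [r']` from the five relations
  have e : KZ.of r - KZ.of r' =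
      (KZ.of r - (KZ.of s - KZ.of s')) - (KZ.of r' - (KZ.of t - KZ.of t'))
        + (KZ.of u - KZ.of v) - (KZ.of u - KZ.of s - KZ.of t') + (KZ.of v - KZ.of t - KZ.of s') := by
    abel
  show KZ.of r - KZ.of r' ∈ KZ.relations
  rw [e]
  exact add_mem (sub_mem (add_mem (sub_mem hrs hrt) hE) hum) hvm

/-- The skeleton closes the piece from its three stubs. -/
theorem KZDimTwo_holds_of_stubs : KZDimTwo := KZDimTwo_of stub_solids stub_mergeSolids stub_solidVolumes

end Summit.KontsevichZagierPeriods.KontsevichZagierPeriods.Cruxes.ExcursionBudget.KZDimTwoLine
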